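import Mathlib
import HarnessLib
import Summits.NavierStokesRegularity.NavierStokesRegularity.Theorems.WakeRatchetMinimalViscousBlowupMaximalBlowup
import Summits.NavierStokesRegularity.NavierStokesRegularity.Theorems.WakeRatchetMinimalViscousBlowupLitMeasureEnergy

/-!
# Route `WakeRatchet`, crux `MinimalViscousBlowup` (stmt-NavierStokesRegularity-22743), LINE g11-1 «threshold ray» (skeleton v3.10
# ebed8644104749ae), HEART stub α2 `stub_ceilingCriticalWindow` — the AVERAGED CEILING (support lemma «AV» of STUB-PLAN-subThresholdCeilingOn §3,
# signature sketch `bc/averaged_ceiling_sig.lean`)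

The heart stub α2 asks for a UNIFORM ceiling `λⁿ‖X'_n(t)‖² ≤ S₂·ν'²` on `[0,T₀]` over the global regular solutions `X'` at viscosities in a window
`(ν, ν+δ)` above the threshold.  This file lands its AVERAGED form, for EVERY global regular solution at EVERY viscosity `ν > 0` (no threshold,
no window): the ceiling `S·ν²` can fail at shell `k` only on a time set of measure `≤ E₀/(S ν³)·λ^{−k}` (`averagedCeiling_shell`), hence at SOME
shell only on a time set of measure `≤ E₀/(S ν³)·(1+ε₀)/ε₀` (`averagedCeiling`), `E₀ = ½‖X₀‖²` — i.e. `O(1/S)`, uniformly in the horizon and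
monotonically BETTER for larger viscosity (so uniform over the whole half-line `ν' ≥ ν` of the stub).  Engine: the landed one-power lit-measure
bound `litMeasure_window_le_energy` (energy identity + top-flux decay + FTC + Markov), transported to `ViscousGlobal` trajectories (whose clauses
are stated on `t ≥ 0` only) through the time-clamped family `X̃_{i,n}(t) = X_{i,n}(max t 0)`.
What it does NOT give: the sup-in-time ceiling of α2 (the exceptional set is small but not empty); the gap is, again, a clock.
MODEL lattice only (nothing about Navier–Stokes; no NS regularity statement is proved; no stub is closed by name).
`--supports stmt-NavierStokesRegularity-22743 --as helper`.
[cite: Tao2016AveragedNS, §4 proof of (4.13) (energy identity with the cancellation (4.3)), Lemma 4.1 (4.5), (4.11)]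
-/

noncomputable section

set_option linter.dupNamespace false

open Set Filter Topology MeasureTheory
open Literature.Analysis.FluidPDE Literature.Analysis.FluidPDE.TaoCascade

namespace Summit.NavierStokesRegularity.NavierStokesRegularity.Theorems.MinimalViscousBlowup.ThresholdRay

/-- **Averaged ceiling, one shell.**  For a GLOBAL regular solution of the NS-scaled `ν`-viscous lattice from the one-shell datum `X₀`
(`ViscousGlobal`; cancelling table with `|α_{··(0,0,1)}| ≤ 1`), every horizon `T₀ > 0`, level `b > 0` and shell `k`:
`volume ({s : b < λ^k‖X_k(s)‖²} ∩ (0,T₀]) ≤ E₀/(ν b λ^k)`, `E₀ = Σ_i ½X₀ᵢ²`. [cite: Tao2016AveragedNS, §4 proof of (4.13), Lemma 4.1 (4.5)] -/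
theorem averagedCeiling_shell {ε₀ ν : ℝ} (hε : 0 < ε₀) (hν : 0 < ν)
    {α : Fin 4 → Fin 4 → Fin 4 → ℤ × ℤ × ℤ → ℝ} (hcan : IsCancellingCoeff α)
    (hα1 : ∀ i₁ i₂ i₃, |α i₁ i₂ i₃ (0, 0, 1)| ≤ 1) {X₀ : Fin 4 → ℝ} {X : Fin 4 → ℤ → ℝ → ℝ}
    (hX : ViscousGlobal ε₀ ν α X₀ X) {T₀ b : ℝ} (hT₀ : 0 < T₀) (hb : 0 < b) (k : ℕ) :
    volume ({s : ℝ | b < (1 + ε₀) ^ k * ‖shellVec X k s‖ ^ 2} ∩ Ioc 0 T₀) ≤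
      ENNReal.ofReal ((∑ i : Fin 4, (1 / 2 : ℝ) * X₀ i ^ 2) / (ν * b * (1 + ε₀) ^ k)) := by
  -- the time-clamped family agrees with `X` on `t ≥ 0` and has no low shells at any time
  set Y : Fin 4 → ℤ → ℝ → ℝ := fun i n t => X i n (max t 0) with hY
  have hYX : ∀ t : ℝ, 0 ≤ t → ∀ (i : Fin 4) (n : ℤ), Y i n t = X i n t := by
    intro t ht i n; rw [hY]; dsimp only; rw [max_eq_left ht]
  have hYvec : ∀ t : ℝ, 0 ≤ t → ∀ n : ℤ, shellVec Y n t = shellVec X n t := by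
    intro t ht n
    unfold shellVec
    congr 1
    funext j
    exact hYX t ht j n
  set T : ℝ := T₀ + 1 with hT
  have hT₀T : T₀ < T := by rw [hT]; linarith
  have hcd : ∀ i n, ContDiffOn ℝ 1 (Y i n) (Ico 0 T) := by
    intro i n
    exact ((hX.contDiffOn i n).mono fun t ht => ht.1).congr fun t ht => hYX t ht.1 i n
  have hinit : ∀ i n, Y i n 0 = if n = 0 then X₀ i else 0 := by
    intro i n; rw [hYX 0 le_rfl]; exact hX.init i n
  have hlow : ∀ i n t, n < 0 → Y i n t = 0 := by
    intro i n t hn; rw [hY]; dsimp only; exact hX.noLow i n _ hn (le_max_right _ _)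
  have hmot : ∀ i n t, 0 ≤ t → t < T → derivWithin (Y i n) (Ici 0) t =
      quadTerm ε₀ α Y i n t - ν * (1 + ε₀) ^ ((2 : ℝ) * n) * Y i n t := by
    intro i n t ht _
    have hEq : EqOn (Y i n) (X i n) (Ici 0) := fun s hs => hYX s hs i n
    rw [derivWithin_congr hEq (hYX t ht i n), hX.motion i n t ht,
      quadTerm_congr_at (fun j k' => (hYX t ht j k').symm) i n, hYX t ht i n]
  have hreg : ∀ T' : ℝ, 0 < T' → T' < T → ∃ M : ℝ, ∀ t : ℝ, 0 ≤ t → t ≤ T' →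
      ∀ (i : Fin 4) (n : ℤ), (1 + (1 + ε₀) ^ ((10 : ℝ) * n)) * |Y i n t| ≤ M := by
    intro T' hT' _
    obtain ⟨M, hM⟩ := hX.apriori T' hT'
    refine ⟨M, fun t ht htT i n => ?_⟩
    rw [hYX t ht i n]
    exact hM t ⟨ht, htT⟩ i n
  have h := litMeasure_window_le_energy hε hν hcan hα1 hcd hinit hlow hmot hreg hT₀ hT₀T hb k
  have hset : {s : ℝ | b < (1 + ε₀) ^ k * ‖shellVec X k s‖ ^ 2} ∩ Ioc 0 T₀
      = {s : ℝ | b < (1 + ε₀) ^ k * ‖shellVec Y k s‖ ^ 2} ∩ Ioc 0 T₀ := by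
    ext s
    constructor
    · rintro ⟨hs, hI⟩; exact ⟨by rw [Set.mem_setOf_eq, hYvec s hI.1.le]; exact hs, hI⟩
    · rintro ⟨hs, hI⟩; exact ⟨by rw [Set.mem_setOf_eq, ← hYvec s hI.1.le]; exact hs, hI⟩
  rw [hset]
  exact h

/-- **AVERAGED CEILING (the averaged form of the heart stub α2).**  For a global regular solution of the `ν`-viscous lattice from `X₀`
(cancelling table, `|α_{··(0,0,1)}| ≤ 1`), every horizon `T₀ > 0` and level `b > 0`, the set of times in `(0,T₀]` at which SOME shell exceeds
the level, `{s : ∃ k, b < λ^k‖X_k(s)‖²}`, has measure `≤ E₀/(ν b)·(1+ε₀)/ε₀` (`Σ_k λ^{−k} = (1+ε₀)/ε₀`).  With `b = S·ν²`: the shell-Reynolds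
ceiling `S` fails only on a time set of measure `≤ ‖X₀‖²(1+ε₀)/(2 ε₀ S ν³) = O(1/S)`, decreasing in `ν`.  MODEL lattice only.
[cite: Tao2016AveragedNS, §4 proof of (4.13), Lemma 4.1 (4.5)] -/
theorem averagedCeiling {ε₀ ν : ℝ} (hε : 0 < ε₀) (hν : 0 < ν)
    {α : Fin 4 → Fin 4 → Fin 4 → ℤ × ℤ × ℤ → ℝ} (hcan : IsCancellingCoeff α)
    (hα1 : ∀ i₁ i₂ i₃, |α i₁ i₂ i₃ (0, 0, 1)| ≤ 1) {X₀ : Fin 4 → ℝ} {X : Fin 4 → ℤ → ℝ → ℝ}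
    (hX : ViscousGlobal ε₀ ν α X₀ X) {T₀ b : ℝ} (hT₀ : 0 < T₀) (hb : 0 < b) :
    volume ({s : ℝ | ∃ k : ℕ, b < (1 + ε₀) ^ k * ‖shellVec X k s‖ ^ 2} ∩ Ioc 0 T₀) ≤
      ENNReal.ofReal ((∑ i : Fin 4, (1 / 2 : ℝ) * X₀ i ^ 2) / (ν * b) * ((1 + ε₀) / ε₀)) := by
  have hl0 : (0 : ℝ) < 1 + ε₀ := by linarith
  have hl1 : (1 : ℝ) < 1 + ε₀ := by linarith
  set E₀ : ℝ := ∑ i : Fin 4, (1 / 2 : ℝ) * X₀ i ^ 2 with hE₀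
  have hE₀0 : 0 ≤ E₀ := Finset.sum_nonneg fun i _ => by positivity
  set r : ℝ := (1 + ε₀)⁻¹ with hr
  have hr0 : 0 ≤ r := by rw [hr]; exact inv_nonneg.2 hl0.le
  have hr1 : r < 1 := by rw [hr]; exact inv_lt_one_of_one_lt₀ hl1
  set c : ℝ := E₀ / (ν * b) with hc
  have hc0 : 0 ≤ c := by rw [hc]; positivity
  -- the set is the union over the shells
  have hU : {s : ℝ | ∃ k : ℕ, b < (1 + ε₀) ^ k * ‖shellVec X k s‖ ^ 2} ∩ Ioc 0 T₀
      = ⋃ k : ℕ, ({s : ℝ | b < (1 + ε₀) ^ k * ‖shellVec X k s‖ ^ 2} ∩ Ioc 0 T₀) := by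
    ext s; simp only [mem_inter_iff, mem_setOf_eq, mem_iUnion]
    constructor
    · rintro ⟨⟨k, hk⟩, hI⟩; exact ⟨k, hk, hI⟩
    · rintro ⟨k, hk, hI⟩; exact ⟨⟨k, hk⟩, hI⟩
  -- per-shell bound in the form `c · r^k`
  have hshell : ∀ k : ℕ, volume ({s : ℝ | b < (1 + ε₀) ^ k * ‖shellVec X k s‖ ^ 2} ∩ Ioc 0 T₀)
      ≤ ENNReal.ofReal (c * r ^ k) := by
    intro k
    have h := averagedCeiling_shell hε hν hcan hα1 hX hT₀ hb k
    rw [← hE₀] at h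
    refine h.trans (le_of_eq ?_)
    congr 1
    have hpk : (0 : ℝ) < (1 + ε₀) ^ k := pow_pos hl0 k
    rw [hc, hr, inv_pow]
    field_simp
  have hsum : Summable (fun k : ℕ => c * r ^ k) := (summable_geometric_of_lt_one hr0 hr1).mul_left c
  have htsum : ∑' k : ℕ, c * r ^ k = c * ((1 + ε₀) / ε₀) := by
    rw [tsum_mul_left, tsum_geometric_of_lt_one hr0 hr1, hr]
    congr 1
    have hε0 : ε₀ ≠ 0 := hε.ne'
    have h1 : 1 - (1 + ε₀)⁻¹ = ε₀ / (1 + ε₀) := by field_simp; ring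
    rw [h1, inv_div]
  rw [hU]
  calc volume (⋃ k : ℕ, ({s : ℝ | b < (1 + ε₀) ^ k * ‖shellVec X k s‖ ^ 2} ∩ Ioc 0 T₀))
      ≤ ∑' k : ℕ, volume ({s : ℝ | b < (1 + ε₀) ^ k * ‖shellVec X k s‖ ^ 2} ∩ Ioc 0 T₀) := measure_iUnion_le _
    _ ≤ ∑' k : ℕ, ENNReal.ofReal (c * r ^ k) := ENNReal.tsum_le_tsum hshell
    _ = ENNReal.ofReal (∑' k : ℕ, c * r ^ k) :=
        (ENNReal.ofReal_tsum_of_nonneg (fun k => by positivity) hsum).symm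
    _ = ENNReal.ofReal (c * ((1 + ε₀) / ε₀)) := by rw [htsum]
    _ = ENNReal.ofReal (E₀ / (ν * b) * ((1 + ε₀) / ε₀)) := by rw [hc]

/-- **Averaged ceiling in shell-Reynolds currency (α2's currency).**  For a global regular `ν`-viscous solution from `X₀` and every `S > 0`,
the times in `(0,T₀]` at which some shell-Reynolds number exceeds `S` (`S·ν² < λ^k‖X_k‖²`) form a set of measure
`≤ (Σ_i ½X₀ᵢ²)/(S ν³)·(1+ε₀)/ε₀` — `O(1/S)`, uniform in the horizon, and only smaller for larger `ν` (hence uniform on every half-line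
`ν' ≥ ν`, the regime of `stub_ceilingCriticalWindow`).  MODEL lattice only. [cite: Tao2016AveragedNS, §4 proof of (4.13), Lemma 4.1 (4.5)] -/
theorem averagedCeiling_reynolds {ε₀ ν : ℝ} (hε : 0 < ε₀) (hν : 0 < ν)
    {α : Fin 4 → Fin 4 → Fin 4 → ℤ × ℤ × ℤ → ℝ} (hcan : IsCancellingCoeff α)
    (hα1 : ∀ i₁ i₂ i₃, |α i₁ i₂ i₃ (0, 0, 1)| ≤ 1) {X₀ : Fin 4 → ℝ} {X : Fin 4 → ℤ → ℝ → ℝ}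
    (hX : ViscousGlobal ε₀ ν α X₀ X) {T₀ S : ℝ} (hT₀ : 0 < T₀) (hS : 0 < S) :
    volume ({s : ℝ | ∃ k : ℕ, S * ν ^ 2 < (1 + ε₀) ^ k * ‖shellVec X k s‖ ^ 2} ∩ Ioc 0 T₀) ≤
      ENNReal.ofReal ((∑ i : Fin 4, (1 / 2 : ℝ) * X₀ i ^ 2) / (S * ν ^ 3) * ((1 + ε₀) / ε₀)) := by
  have h := averagedCeiling hε hν hcan hα1 hX hT₀ (mul_pos hS (pow_pos hν 2))
  refine h.trans (le_of_eq ?_)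
  congr 1
  have hν0 : ν ≠ 0 := hν.ne'
  have hS0 : S ≠ 0 := hS.ne'
  rw [div_mul_eq_mul_div, div_mul_eq_mul_div, pow_succ, ← mul_assoc (S)]
  field_simp

end Summit.NavierStokesRegularity.NavierStokesRegularity.Theorems.MinimalViscousBlowup.ThresholdRay

end
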